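import Summits.CriticalPhenomena.PercolationContinuityZ3.Theorems.PercNearOneGluingNoHeavyLowerTailSahiLatinZeroBottomRelaxedCore

/-!
# `NoHeavyLowerTail` (crux stmt-CriticalPhenomena-4575), Sahi programme (prim-master-conj gen 51): **THE HALF-CORE REDUCTION** — the grid invariant
# for an ARBITRARY nested pair `S ⊆ S′` on the `P`-side against a private cut `T` on the `Q`-side, reduced to two ONE-BLOCK inequalities on `(S, S′∖S)`

Support file (`--supports stmt-CriticalPhenomena-4575`; small definitions (five coefficient functionals, the certificate structure `HalfCoreCert`,
the bound `mHC`) + proofs, no `sorry`, standard axioms).  Memo `run/shared/lean/prim/prim-l12/FROM-prim-master-conj-g51-HALF-CORE.md` §2.  Nothing here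
asserts the crux, Kahn's conjecture or (C¼).

THE MATHEMATICS.  The HALF-CORE instance on `[3]^{U ⊕ V}` is `P = S × Ω`, `b = B × Ω` (think `B = S′ ∖ S` for nested up-sets `S ⊆ S′` of `[3]^U` —
an ARBITRARY prime/cut pair on the `P`-side), `Q = Ω × T`, `c = Ω × Tᶜ` (`T ⊆ [3]^V` arbitrary: a private cut on the `Q`-side).  gen 50's conjecture
(HC) says `Grid4 P b Q c`; with `grid4_factorQ/P` it gives TOP₁ with the sharp constant `3/2` for every zero-bottom instance whose primes have disjoint
supports and whose `Q`-side cut is private.  This file proves the FIBREWISE REDUCTION of (HC) (`grid4_of_fibrewise`, exact along `U`, pointwise along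
`V`): at a point `η` the fibre value is LINEAR in the Latin-triangle data `a = Λ_{T,T}(η)`, `e = Λ_{T,Tᶜ}(η)`, `d = Λ_{Tᶜ,Tᶜ}(η)` of `η` w.r.t. the cut
`(T, Tᶜ)` of `K₃^{⊗V}` (`fibre_in`, `fibre_out`: `N_T = a + e`, `N_{Tᶜ} = e + d`, `2^q = a + 2e + d`), with coefficients `coefA1, coefA2` (η ∈ T) and
`coefB0, coefB1, coefB2` (η ∉ T) that are functionals of the nested up-sets of `[3]^U` alone; the double-counting identities
`Σ_{η∈T} Λ_{T,Tᶜ} = Σ_{η∉T} Λ_{T,T}` and `Σ_{η∈T} Λ_{Tᶜ,Tᶜ} = Σ_{η∉T} Λ_{T,Tᶜ}` (`sum_Lam_comm`) then show (`grid4_halfCore`):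
   if `L₁ ≤ coefA1`, `L₂ ≤ coefA2`, `0 ≤ coefB0`, `M₁ ≤ coefB1`, `M₂ ≤ coefB2` on all admissible families and `L₁ + M₂ ≥ 0`, `L₂ + M₁ ≥ 0`
   (a `HalfCoreCert S B L₁ L₂ M₁ M₂`), then `Grid4 (S×Ω) (B×Ω) (Ω×T) (Ω×Tᶜ)` for EVERY `V` and EVERY `T`,
and `coefB0 ≥ 0` is discharged in general (`coefB0_nonneg`, Harris).  The two remaining one-block inequalities ((Uβ), (Uγ) of the memo) hold for every
nested pair of up-sets of `[3]^U` with `|U| ≤ 2` (exhaustive computation, memo §2; they are OPEN for general `U`) — so this file turns (HC) into two named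
one-block lemmas and yields TOP₁(3/2) (`three_kappa_top_le_two_kappa_lowerStep_of_halfCoreCert`) for every certified pair.  HONEST LABEL: conditional
reduction; (HC) for general `U`, shared primes, (C¼), TOP₁, FBP(d ≥ 5), Kahn remain OPEN. [this work]
-/

namespace Summit.CriticalPhenomena.PercolationContinuityZ3.Theorems.SahiLatin

open Finset

section halfcore
variable {U V : Type} [Fintype U] [DecidableEq U] [Fintype V] [DecidableEq V] (S B : Finset (Pt U)) (T : Finset (Pt V))

/-! ## §1  The four densities on a half-core instance -/

/-- `dSS` on the half-core instance at `(w, η)`: `2XY([η∈T][w∈B] + [w∈S][η∉T] + [w∈B][η∉T])`. [this work] -/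
theorem dSS_hc (w : Pt U) (η : Pt V) :
    dSS (cylL S : Finset (Pt (U ⊕ V))) (cylL B) (cylR T) (cylR Tᶜ) (Sum.elim w η) =
      2 * (2 ^ Fintype.card U * 2 ^ Fintype.card V) *
        (ind T η * ind B w + ind S w * (1 - ind T η) + ind B w * (1 - ind T η)) := by
  unfold dSS
  rw [ind_cylL, ind_cylL, ind_cylR, ind_cylR, ind_compl', pow_succ, two_pow_card_sum, fstPt_elim, sndPt_elim]
  ring

/-- `dSO` on the half-core instance: `X(−[w∈S]N_{Tᶜ}(η) − [w∈B]N_T(η) + 3[w∈B]N_{Tᶜ}(η))`. [this work] -/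
theorem dSO_hc (w : Pt U) (η : Pt V) :
    dSO (cylL S : Finset (Pt (U ⊕ V))) (cylL B) (cylR T) (cylR Tᶜ) (Sum.elim w η) =
      2 ^ Fintype.card U * (-(ind S w * (N Tᶜ η : ℤ)) - ind B w * (N T η : ℤ) + 3 * (ind B w * (N Tᶜ η : ℤ))) := by
  have dQ : (N (cylR T : Finset (Pt (U ⊕ V))) (Sum.elim w η) : ℤ) = 2 ^ Fintype.card U * N T η := by
    have := N_cylR (U := U) T (Sum.elim w η); rw [sndPt_elim] at this; exact_mod_cast this
  have dc : (N (cylR Tᶜ : Finset (Pt (U ⊕ V))) (Sum.elim w η) : ℤ) = 2 ^ Fintype.card U * N Tᶜ η := by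
    have := N_cylR (U := U) Tᶜ (Sum.elim w η); rw [sndPt_elim] at this; exact_mod_cast this
  unfold dSO
  rw [ind_cylL, ind_cylL, dQ, dc, fstPt_elim]
  ring

/-- `dOS` on the half-core instance: `Y(−[η∈T]N_B(w) − [η∉T]N_S(w) + 3[η∉T]N_B(w))`. [this work] -/
theorem dOS_hc (w : Pt U) (η : Pt V) :
    dOS (cylL S : Finset (Pt (U ⊕ V))) (cylL B) (cylR T) (cylR Tᶜ) (Sum.elim w η) =
      2 ^ Fintype.card V * (-(ind T η * (N B w : ℤ)) - (1 - ind T η) * (N S w : ℤ) + 3 * ((1 - ind T η) * (N B w : ℤ))) := by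
  have dP : (N (cylL S : Finset (Pt (U ⊕ V))) (Sum.elim w η) : ℤ) = N S w * 2 ^ Fintype.card V := by
    have := N_cylL (V := V) S (Sum.elim w η); rw [fstPt_elim] at this; exact_mod_cast this
  have db : (N (cylL B : Finset (Pt (U ⊕ V))) (Sum.elim w η) : ℤ) = N B w * 2 ^ Fintype.card V := by
    have := N_cylL (V := V) B (Sum.elim w η); rw [fstPt_elim] at this; exact_mod_cast this
  unfold dOS
  rw [ind_cylR, ind_cylR, ind_compl', dP, db, sndPt_elim]
  ring

/-- `dOO` on the half-core instance: `−4·N_B(w)·N_{Tᶜ}(η)` (block independence). [this work] -/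
theorem dOO_hc (w : Pt U) (η : Pt V) :
    dOO (cylL S : Finset (Pt (U ⊕ V))) (cylL B) (cylR T) (cylR Tᶜ) (Sum.elim w η) = -4 * ((N B w : ℤ) * (N Tᶜ η : ℤ)) := by
  have dQb : (N ((cylR T : Finset (Pt (U ⊕ V))) ∩ cylL B) (Sum.elim w η) : ℤ) = N B w * N T η := by
    have := N_cylL_inter_cylR B T (Sum.elim w η); rw [inter_comm, fstPt_elim, sndPt_elim] at this; exact_mod_cast this
  have dPc : (N ((cylL S : Finset (Pt (U ⊕ V))) ∩ cylR Tᶜ) (Sum.elim w η) : ℤ) = N S w * N Tᶜ η := by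
    have := N_cylL_inter_cylR S Tᶜ (Sum.elim w η); rw [fstPt_elim, sndPt_elim] at this; exact_mod_cast this
  have dbc : (N ((cylL B : Finset (Pt (U ⊕ V))) ∩ cylR Tᶜ) (Sum.elim w η) : ℤ) = N B w * N Tᶜ η := by
    have := N_cylL_inter_cylR B Tᶜ (Sum.elim w η); rw [fstPt_elim, sndPt_elim] at this; exact_mod_cast this
  have lPc : (Lam (cylL S : Finset (Pt (U ⊕ V))) (cylR Tᶜ) (Sum.elim w η) : ℤ) = N S w * N Tᶜ η := by
    have := Lam_cylL_cylR S Tᶜ (Sum.elim w η); rw [fstPt_elim, sndPt_elim] at this; exact_mod_cast this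
  have lbQ : (Lam (cylL B : Finset (Pt (U ⊕ V))) (cylR T) (Sum.elim w η) : ℤ) = N B w * N T η := by
    have := Lam_cylL_cylR B T (Sum.elim w η); rw [fstPt_elim, sndPt_elim] at this; exact_mod_cast this
  have lbc : (Lam (cylL B : Finset (Pt (U ⊕ V))) (cylR Tᶜ) (Sum.elim w η) : ℤ) = N B w * N Tᶜ η := by
    have := Lam_cylL_cylR B Tᶜ (Sum.elim w η); rw [fstPt_elim, sndPt_elim] at this; exact_mod_cast this
  unfold dOO
  rw [dQb, dPc, dbc, lPc, lbQ, lbc]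
  ring


/-! ## §2  The five coefficient functionals (functionals of nested up-sets of `[3]^U` only) -/

/-- `N(J;B) = Σ_{w∈J} N_B(w)` (number of Latin pairs from `J` into `B`). [this work] -/
def nIn (B J : Finset (Pt U)) : ℤ := ∑ w ∈ J, (N B w : ℤ)

/-- Coefficient of `Λ_{T,Tᶜ}(η)` in the fibre value at a point `η ∈ T`:  `2X|B| − X|J_SO∩S| + 2X|J_SO∩B| − 4N(J_OO;B)`. [this work] -/
def coefA1 (JSO JOO : Finset (Pt U)) : ℤ :=
  2 * 2 ^ Fintype.card U * B.card - 2 ^ Fintype.card U * (JSO ∩ S).card + 2 * 2 ^ Fintype.card U * (JSO ∩ B).card - 4 * nIn B JOO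

/-- Coefficient of `Λ_{Tᶜ,Tᶜ}(η)` at `η ∈ T`:  `X|B| − X|J_SO∩S| + 3X|J_SO∩B| − 4N(J_OO;B)`. [this work] -/
def coefA2 (JSO JOO : Finset (Pt U)) : ℤ :=
  2 ^ Fintype.card U * B.card - 2 ^ Fintype.card U * (JSO ∩ S).card + 3 * 2 ^ Fintype.card U * (JSO ∩ B).card - 4 * nIn B JOO

/-- Coefficient of `Λ_{Tᶜ,Tᶜ}(η)` at `η ∉ T`:  `2X(|J_SS∩S|+|J_SS∩B|) − X|J_SO∩S| + 3X|J_SO∩B| + (3N(J_OS;B) − N(J_OS;S)) − 4N(J_OO;B)`. [this work] -/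
def coefB0 (JSS JSO JOS JOO : Finset (Pt U)) : ℤ :=
  2 * 2 ^ Fintype.card U * ((JSS ∩ S).card + (JSS ∩ B).card) - 2 ^ Fintype.card U * (JSO ∩ S).card
    + 3 * 2 ^ Fintype.card U * (JSO ∩ B).card + (3 * nIn B JOS - nIn S JOS) - 4 * nIn B JOO

/-- Coefficient of `Λ_{T,Tᶜ}(η)` at `η ∉ T`:  `4X(|J_SS∩S|+|J_SS∩B|) − X|J_SO∩S| + 2X|J_SO∩B| + 2(3N(J_OS;B) − N(J_OS;S)) − 4N(J_OO;B)`. [this work] -/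
def coefB1 (JSS JSO JOS JOO : Finset (Pt U)) : ℤ :=
  4 * 2 ^ Fintype.card U * ((JSS ∩ S).card + (JSS ∩ B).card) - 2 ^ Fintype.card U * (JSO ∩ S).card
    + 2 * 2 ^ Fintype.card U * (JSO ∩ B).card + 2 * (3 * nIn B JOS - nIn S JOS) - 4 * nIn B JOO

/-- Coefficient of `Λ_{T,T}(η)` at `η ∉ T`:  `2X(|J_SS∩S|+|J_SS∩B|) − X|J_SO∩B| + (3N(J_OS;B) − N(J_OS;S))`. [this work] -/
def coefB2 (JSS JSO JOS : Finset (Pt U)) : ℤ :=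
  2 * 2 ^ Fintype.card U * ((JSS ∩ S).card + (JSS ∩ B).card) - 2 ^ Fintype.card U * (JSO ∩ B).card + (3 * nIn B JOS - nIn S JOS)

/-! ## §3  The fibre values are linear in the Latin-triangle data of `η` -/

omit [DecidableEq U] in
/-- `Σ_{w∈J} (α[w∈S] + β[w∈B]) = α|J∩S| + β|J∩B|`. [this work] -/
theorem sum_lin_ind (J : Finset (Pt U)) (α β : ℤ) :
    ∑ w ∈ J, (α * ind S w + β * ind B w) = α * (J ∩ S).card + β * (J ∩ B).card := by
  rw [sum_add_distrib, ← mul_sum, ← mul_sum, sum_ind_eq_card_inter, sum_ind_eq_card_inter]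

/-- `Σ_{w∈J} (α N_B(w) + β N_S(w)) = α N(J;B) + β N(J;S)`. [this work] -/
theorem sum_lin_N (J : Finset (Pt U)) (α β : ℤ) :
    ∑ w ∈ J, (α * (N B w : ℤ) + β * (N S w : ℤ)) = α * nIn B J + β * nIn S J := by
  unfold nIn; rw [sum_add_distrib, ← mul_sum, ← mul_sum]

/-- The Latin-triangle bookkeeping at a point: `N_T = Λ_{TT} + Λ_{TTᶜ}`, `N_{Tᶜ} = Λ_{TTᶜ} + Λ_{TᶜTᶜ}`, `2^q = Λ_{TT} + 2Λ_{TTᶜ} + Λ_{TᶜTᶜ}`. [this work] -/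
theorem latin_data (η : Pt V) :
    (N T η : ℤ) = Lam T T η + Lam T Tᶜ η ∧ (N Tᶜ η : ℤ) = Lam T Tᶜ η + Lam Tᶜ Tᶜ η ∧
      (2 : ℤ) ^ Fintype.card V = Lam T T η + 2 * Lam T Tᶜ η + Lam Tᶜ Tᶜ η := by
  have h1 : (N T η : ℤ) = Lam T T η + Lam T Tᶜ η := by exact_mod_cast N_eq_Lam_add_Lam_compl T T η
  have h2 : (N Tᶜ η : ℤ) = Lam T Tᶜ η + Lam Tᶜ Tᶜ η := by
    have := N_eq_Lam_add_Lam_compl Tᶜ T η; rw [Lam_comm Tᶜ T η] at this; exact_mod_cast this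
  have h3 : (N T η : ℤ) + N Tᶜ η = 2 ^ Fintype.card V := by exact_mod_cast N_add_N_compl T η
  exact ⟨h1, h2, by linarith⟩

/-- **Fibre value at `η ∈ T`** (`J_SS = J_OS = Ω` forced): `a·X(|B| − |J_SO∩B|) + e·coefA1 + d·coefA2` with `(a,e,d) = (Λ_{TT}, Λ_{TTᶜ}, Λ_{TᶜTᶜ})(η)`. [this work] -/
theorem fibre_in {η : Pt V} (hη : η ∈ T) (JSO JOO : Finset (Pt U)) :
    ∑ w, dSS (cylL S : Finset (Pt (U ⊕ V))) (cylL B) (cylR T) (cylR Tᶜ) (Sum.elim w η)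
      + ∑ w ∈ JSO, dSO (cylL S : Finset (Pt (U ⊕ V))) (cylL B) (cylR T) (cylR Tᶜ) (Sum.elim w η)
      + ∑ w, dOS (cylL S : Finset (Pt (U ⊕ V))) (cylL B) (cylR T) (cylR Tᶜ) (Sum.elim w η)
      + ∑ w ∈ JOO, dOO (cylL S : Finset (Pt (U ⊕ V))) (cylL B) (cylR T) (cylR Tᶜ) (Sum.elim w η)
    = (Lam T T η : ℤ) * (2 ^ Fintype.card U * (B.card - (JSO ∩ B).card))
      + (Lam T Tᶜ η : ℤ) * coefA1 S B JSO JOO + (Lam Tᶜ Tᶜ η : ℤ) * coefA2 S B JSO JOO := by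
  obtain ⟨h1, h2, h3⟩ := latin_data T η
  have hT : ind T η = 1 := ind_of_mem hη
  have eSS : ∑ w, dSS (cylL S : Finset (Pt (U ⊕ V))) (cylL B) (cylR T) (cylR Tᶜ) (Sum.elim w η)
      = 2 * (2 ^ Fintype.card U * 2 ^ Fintype.card V) * B.card := by
    rw [show (B.card : ℤ) = ((univ : Finset (Pt U)) ∩ B).card by rw [univ_inter], ← sum_ind_eq_card_inter, mul_sum]
    exact sum_congr rfl fun w _ => by rw [dSS_hc, hT]; ring
  have eSO : ∑ w ∈ JSO, dSO (cylL S : Finset (Pt (U ⊕ V))) (cylL B) (cylR T) (cylR Tᶜ) (Sum.elim w η)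
      = (-(2 ^ Fintype.card U * (N Tᶜ η : ℤ))) * (JSO ∩ S).card
        + (2 ^ Fintype.card U * (3 * (N Tᶜ η : ℤ) - N T η)) * (JSO ∩ B).card := by
    rw [← sum_lin_ind]
    exact sum_congr rfl fun w _ => by rw [dSO_hc]; ring
  have eOS : ∑ w, dOS (cylL S : Finset (Pt (U ⊕ V))) (cylL B) (cylR T) (cylR Tᶜ) (Sum.elim w η)
      = -(2 ^ Fintype.card V * (2 ^ Fintype.card U * (B.card : ℤ))) := by
    rw [← sum_N B, mul_sum, ← sum_neg_distrib]
    exact sum_congr rfl fun w _ => by rw [dOS_hc, hT]; ring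
  have eOO : ∑ w ∈ JOO, dOO (cylL S : Finset (Pt (U ⊕ V))) (cylL B) (cylR T) (cylR Tᶜ) (Sum.elim w η)
      = -4 * (N Tᶜ η : ℤ) * nIn B JOO := by
    unfold nIn; rw [mul_sum]
    exact sum_congr rfl fun w _ => by rw [dOO_hc]; ring
  rw [eSS, eSO, eOS, eOO, h1, h2, h3]
  unfold coefA1 coefA2
  ring

/-- **Fibre value at `η ∉ T`**: `d·coefB0 + e·coefB1 + a·coefB2`. [this work] -/
theorem fibre_out {η : Pt V} (hη : η ∉ T) (JSS JSO JOS JOO : Finset (Pt U)) :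
    ∑ w ∈ JSS, dSS (cylL S : Finset (Pt (U ⊕ V))) (cylL B) (cylR T) (cylR Tᶜ) (Sum.elim w η)
      + ∑ w ∈ JSO, dSO (cylL S : Finset (Pt (U ⊕ V))) (cylL B) (cylR T) (cylR Tᶜ) (Sum.elim w η)
      + ∑ w ∈ JOS, dOS (cylL S : Finset (Pt (U ⊕ V))) (cylL B) (cylR T) (cylR Tᶜ) (Sum.elim w η)
      + ∑ w ∈ JOO, dOO (cylL S : Finset (Pt (U ⊕ V))) (cylL B) (cylR T) (cylR Tᶜ) (Sum.elim w η)
    = (Lam Tᶜ Tᶜ η : ℤ) * coefB0 S B JSS JSO JOS JOO + (Lam T Tᶜ η : ℤ) * coefB1 S B JSS JSO JOS JOO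
      + (Lam T T η : ℤ) * coefB2 S B JSS JSO JOS := by
  obtain ⟨h1, h2, h3⟩ := latin_data T η
  have hT : ind T η = 0 := ind_of_not_mem hη
  have eSS : ∑ w ∈ JSS, dSS (cylL S : Finset (Pt (U ⊕ V))) (cylL B) (cylR T) (cylR Tᶜ) (Sum.elim w η)
      = 2 * (2 ^ Fintype.card U * 2 ^ Fintype.card V) * (JSS ∩ S).card
        + 2 * (2 ^ Fintype.card U * 2 ^ Fintype.card V) * (JSS ∩ B).card := by
    rw [← sum_lin_ind]
    exact sum_congr rfl fun w _ => by rw [dSS_hc, hT]; ring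
  have eSO : ∑ w ∈ JSO, dSO (cylL S : Finset (Pt (U ⊕ V))) (cylL B) (cylR T) (cylR Tᶜ) (Sum.elim w η)
      = (-(2 ^ Fintype.card U * (N Tᶜ η : ℤ))) * (JSO ∩ S).card
        + (2 ^ Fintype.card U * (3 * (N Tᶜ η : ℤ) - N T η)) * (JSO ∩ B).card := by
    rw [← sum_lin_ind]
    exact sum_congr rfl fun w _ => by rw [dSO_hc]; ring
  have eOS : ∑ w ∈ JOS, dOS (cylL S : Finset (Pt (U ⊕ V))) (cylL B) (cylR T) (cylR Tᶜ) (Sum.elim w η)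
      = (2 ^ Fintype.card V * 3) * nIn B JOS + (-(2 ^ Fintype.card V)) * nIn S JOS := by
    rw [← sum_lin_N]
    exact sum_congr rfl fun w _ => by rw [dOS_hc, hT]; ring
  have eOO : ∑ w ∈ JOO, dOO (cylL S : Finset (Pt (U ⊕ V))) (cylL B) (cylR T) (cylR Tᶜ) (Sum.elim w η)
      = -4 * (N Tᶜ η : ℤ) * nIn B JOO := by
    unfold nIn; rw [mul_sum]
    exact sum_congr rfl fun w _ => by rw [dOO_hc]; ring
  rw [eSS, eSO, eOS, eOO, h1, h2, h3]
  unfold coefB0 coefB1 coefB2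
  ring


/-! ## §4  The certificate, the bound function and the reduction theorem -/

/-- **Half-core certificate** for the pair `(S, B)` (one block `U`): constants `L₁, L₂, M₁, M₂` bounding the fibre coefficients from below on every
admissible nested family of up-sets of `[3]^U`, with `L₁ + M₂ ≥ 0` and `L₂ + M₁ ≥ 0` — the two ONE-BLOCK inequalities (Uβ), (Uγ) of the memo, plus the
(always available, `coefB0_nonneg`) sign of `coefB0`. [this work] -/
structure HalfCoreCert (L₁ L₂ M₁ M₂ : ℤ) : Prop where
  /-- bounds at points `η ∈ T` -/
  condA : ∀ JSO JOO : Finset (Pt U), IsUpperSet (JSO : Set (Pt U)) → IsUpperSet (JOO : Set (Pt U)) → JOO ⊆ JSO → S ⊆ JSO →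
    L₁ ≤ coefA1 S B JSO JOO ∧ L₂ ≤ coefA2 S B JSO JOO
  /-- bounds at points `η ∉ T` -/
  condB : ∀ JSS JSO JOS JOO : Finset (Pt U), IsUpperSet (JSS : Set (Pt U)) → IsUpperSet (JSO : Set (Pt U)) →
    IsUpperSet (JOS : Set (Pt U)) → IsUpperSet (JOO : Set (Pt U)) → JOO ⊆ JSO → JOO ⊆ JOS → JSO ⊆ JSS → JOS ⊆ JSS → S ⊆ JSS → S ⊆ JSO →
    0 ≤ coefB0 S B JSS JSO JOS JOO ∧ M₁ ≤ coefB1 S B JSS JSO JOS JOO ∧ M₂ ≤ coefB2 S B JSS JSO JOS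
  /-- the two sign conditions -/
  sum₁ : 0 ≤ L₁ + M₂
  sum₂ : 0 ≤ L₂ + M₁

/-- **`coefB0 ≥ 0` always** (for `S ∪ B` an up-set with `S ∩ B = ∅`; `J_OO ⊆ J_OS ⊆ J_SS ⊇ J_SO`): Harris for the up-sets `J_OS` and `S ∪ B` — so the
first conjunct of `HalfCoreCert.condB` is never an obstruction. [this work] -/
theorem coefB0_nonneg (hSB : Disjoint S B) (hS' : IsUpperSet ((S ∪ B : Finset (Pt U)) : Set (Pt U))) {JSS JSO JOS JOO : Finset (Pt U)}
    (uOS : IsUpperSet (JOS : Set (Pt U))) (n2 : JOO ⊆ JOS) (n3 : JSO ⊆ JSS) (n4 : JOS ⊆ JSS) :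
    0 ≤ coefB0 S B JSS JSO JOS JOO := by
  unfold coefB0
  have hX : (0 : ℤ) < 2 ^ Fintype.card U := by positivity
  -- N(J_OO;B) ≤ N(J_OS;B)
  have e1 : nIn B JOO ≤ nIn B JOS := by
    unfold nIn; exact sum_le_sum_of_subset_of_nonneg n2 fun w _ _ => by positivity
  -- |J_SO ∩ S| = |S| ≤ |J_SS ∩ S|
  have e2 : ((JSO ∩ S).card : ℤ) ≤ (JSS ∩ S).card := by
    exact_mod_cast card_le_card (inter_subset_inter n3 Subset.rfl)
  -- Harris: N(J_OS; S ∪ B) ≤ X |J_OS ∩ (S ∪ B)| ≤ X(|J_SS ∩ S| + |J_SS ∩ B|)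
  have e3 : nIn B JOS + nIn S JOS ≤ 2 ^ Fintype.card U * ((JSS ∩ S).card + (JSS ∩ B).card) := by
    have hsum : nIn B JOS + nIn S JOS = ∑ w ∈ JOS, (N (S ∪ B) w : ℤ) := by
      unfold nIn; rw [← sum_add_distrib]
      exact sum_congr rfl fun w _ => by rw [N_union_of_disjoint hSB]; push_cast; ring
    have hH : 0 ≤ HS JOS (S ∪ B) := HS_nonneg uOS hS'
    rw [HS_eq, ← sum_N_eq_latinPairs] at hH
    have hc : (((JOS ∩ (S ∪ B)).card : ℕ) : ℤ) ≤ (JSS ∩ S).card + (JSS ∩ B).card := by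
      have : (JOS ∩ (S ∪ B)).card ≤ (JSS ∩ S).card + (JSS ∩ B).card := by
        rw [inter_union_distrib_left]
        exact (card_union_le _ _).trans (Nat.add_le_add (card_le_card (inter_subset_inter n4 Subset.rfl))
          (card_le_card (inter_subset_inter n4 Subset.rfl)))
      exact_mod_cast this
    rw [hsum]; nlinarith
  have e4 : (0 : ℤ) ≤ (JSO ∩ B).card := by positivity
  have e5 : 0 ≤ nIn B JOS := by unfold nIn; positivity
  nlinarith

/-- The per-point bound: `L₁Λ_{TTᶜ} + L₂Λ_{TᶜTᶜ}` at `η ∈ T`, `M₁Λ_{TTᶜ} + M₂Λ_{TT}` at `η ∉ T`. [this work] -/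
def mHC (L₁ L₂ M₁ M₂ : ℤ) (η : Pt V) : ℤ :=
  if η ∈ T then L₁ * (Lam T Tᶜ η : ℤ) + L₂ * (Lam Tᶜ Tᶜ η : ℤ) else M₁ * (Lam T Tᶜ η : ℤ) + M₂ * (Lam T T η : ℤ)

omit [DecidableEq V] in
/-- **Double counting on the cut `(T, Tᶜ)`**: `Σ_η mHC = (L₁ + M₂)·Σ_{η∉T}Λ_{TT} + (L₂ + M₁)·Σ_{η∉T}Λ_{TTᶜ} ≥ 0`. [this work] -/
theorem sum_mHC_nonneg [DecidableEq V] {L₁ L₂ M₁ M₂ : ℤ} (h₁ : 0 ≤ L₁ + M₂) (h₂ : 0 ≤ L₂ + M₁) : 0 ≤ ∑ η, mHC T L₁ L₂ M₁ M₂ η := by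
  rw [← sum_add_sum_compl T]
  have ein : ∑ η ∈ T, mHC T L₁ L₂ M₁ M₂ η = L₁ * ∑ η ∈ T, (Lam T Tᶜ η : ℤ) + L₂ * ∑ η ∈ T, (Lam Tᶜ Tᶜ η : ℤ) := by
    rw [mul_sum, mul_sum, ← sum_add_distrib]
    exact sum_congr rfl fun η hη => by unfold mHC; rw [if_pos hη]
  have eout : ∑ η ∈ Tᶜ, mHC T L₁ L₂ M₁ M₂ η = M₁ * ∑ η ∈ Tᶜ, (Lam T Tᶜ η : ℤ) + M₂ * ∑ η ∈ Tᶜ, (Lam T T η : ℤ) := by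
    rw [mul_sum, mul_sum, ← sum_add_distrib]
    exact sum_congr rfl fun η hη => by unfold mHC; rw [if_neg (mem_compl.1 hη)]
  -- the two identities
  have i1 : ∑ η ∈ Tᶜ, (Lam T T η : ℤ) = ∑ η ∈ T, (Lam T Tᶜ η : ℤ) := by
    rw [sum_Lam_comm Tᶜ T T]; exact sum_congr rfl fun η _ => by rw [Lam_comm]
  have i2 : ∑ η ∈ T, (Lam Tᶜ Tᶜ η : ℤ) = ∑ η ∈ Tᶜ, (Lam T Tᶜ η : ℤ) := sum_Lam_comm T Tᶜ Tᶜ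
  have p1 : 0 ≤ ∑ η ∈ T, (Lam T Tᶜ η : ℤ) := by positivity
  have p2 : 0 ≤ ∑ η ∈ Tᶜ, (Lam T Tᶜ η : ℤ) := by positivity
  rw [ein, eout, i1, i2]
  nlinarith

/-- **THE HALF-CORE REDUCTION**: a half-core certificate for `(S, B)` gives the grid invariant `Grid4 (S×Ω) (B×Ω) (Ω×T) (Ω×Tᶜ)` for EVERY block `V`
and EVERY `T ⊆ [3]^V` (fibrewise relaxation, exact along `U`, pointwise along `V`). [this work] -/
theorem grid4_halfCore {L₁ L₂ M₁ M₂ : ℤ} (hc : HalfCoreCert S B L₁ L₂ M₁ M₂) :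
    Grid4 (cylL S : Finset (Pt (U ⊕ V))) (cylL B) (cylR T) (cylR Tᶜ) := by
  refine grid4_of_fibrewise (mHC T L₁ L₂ M₁ M₂) (sum_mHC_nonneg T hc.sum₁ hc.sum₂) ?_
  intro η JSS JSO JOS JOO u1 u2 u3 u4 n1 n2 n3 n4 f1 f2 f3
  have hS : S ⊆ JSO := fun w hw => f2 w (by rw [mem_cylL, fstPt_elim]; exact hw)
  have a0 : (0 : ℤ) ≤ Lam T T η := by positivity
  have e0 : (0 : ℤ) ≤ Lam T Tᶜ η := by positivity
  have d0 : (0 : ℤ) ≤ Lam Tᶜ Tᶜ η := by positivity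
  by_cases hη : η ∈ T
  · have hQ : ∀ w : Pt U, Sum.elim w η ∈ (cylR T : Finset (Pt (U ⊕ V))) := fun w => by rw [mem_cylR, sndPt_elim]; exact hη
    have hSS : JSS = univ := eq_univ_of_forall fun w => f1 w (mem_union_right _ (hQ w))
    have hOS : JOS = univ := eq_univ_of_forall fun w => f3 w (hQ w)
    subst hSS; subst hOS
    rw [fibre_in S B T hη]
    unfold mHC; rw [if_pos hη]
    obtain ⟨hA1, hA2⟩ := hc.condA JSO JOO u2 u4 n1 hS
    have hB0 : (0 : ℤ) ≤ 2 ^ Fintype.card U * ((B.card : ℤ) - (JSO ∩ B).card) := by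
      have : ((JSO ∩ B).card : ℤ) ≤ B.card := by exact_mod_cast card_le_card inter_subset_right
      have hX : (0 : ℤ) ≤ 2 ^ Fintype.card U := by positivity
      nlinarith
    nlinarith [mul_le_mul_of_nonneg_left hA1 e0, mul_le_mul_of_nonneg_left hA2 d0, mul_nonneg a0 hB0]
  · have hSS : S ⊆ JSS := fun w hw => f1 w (mem_union_left _ (by rw [mem_cylL, fstPt_elim]; exact hw))
    rw [fibre_out S B T hη]
    unfold mHC; rw [if_neg hη]
    obtain ⟨hB0, hB1, hB2⟩ := hc.condB JSS JSO JOS JOO u1 u2 u3 u4 n1 n2 n3 n4 hSS hS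
    nlinarith [mul_le_mul_of_nonneg_left hB1 e0, mul_le_mul_of_nonneg_left hB2 a0, mul_nonneg d0 hB0]

end halfcore

/-! ## §5  The family (half-core instances with a certificate, closed under up-set factor lifts) and TOP₁(3/2) -/

/-- **The certified half-core family**: half-core instances `(S×Ω, B×Ω, Ω×T, Ω×Tᶜ)` with `S ∩ B = ∅` carrying a `HalfCoreCert`, closed under
arbitrary up-set factor lifts on either side. [this work] -/
inductive IsHalfCorePad : ∀ (κ : Type) [Fintype κ] [DecidableEq κ], Finset (Pt κ) → Finset (Pt κ) → Finset (Pt κ) → Finset (Pt κ) → Prop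
  | hcore {U V : Type} [Fintype U] [DecidableEq U] [Fintype V] [DecidableEq V] (S B : Finset (Pt U)) (T : Finset (Pt V))
      (L₁ L₂ M₁ M₂ : ℤ) (hSB : Disjoint S B) (hc : HalfCoreCert S B L₁ L₂ M₁ M₂) :
      IsHalfCorePad (U ⊕ V) (cylL S) (cylL B) (cylR T) (cylR Tᶜ)
  | factorP {W κ : Type} [Fintype W] [DecidableEq W] [Fintype κ] [DecidableEq κ] {A : Finset (Pt W)} (hA : IsUpperSet (A : Set (Pt W)))
      {P b Q c : Finset (Pt κ)} :
      IsHalfCorePad κ P b Q c → IsHalfCorePad (W ⊕ κ) (cylL A ∩ cylR P) (cylL A ∩ cylR b) (cylR Q) (cylR c)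
  | factorQ {W κ : Type} [Fintype W] [DecidableEq W] [Fintype κ] [DecidableEq κ] {B' : Finset (Pt W)} (hB : IsUpperSet (B' : Set (Pt W)))
      {P b Q c : Finset (Pt κ)} :
      IsHalfCorePad κ P b Q c → IsHalfCorePad (W ⊕ κ) (cylR P) (cylR b) (cylL B' ∩ cylR Q) (cylL B' ∩ cylR c)

/-- `Grid4` on the certified half-core family. [this work] -/
theorem grid4_of_isHalfCorePad {κ : Type} [Fintype κ] [DecidableEq κ] {P b Q c : Finset (Pt κ)} (h : IsHalfCorePad κ P b Q c) :
    Grid4 P b Q c := by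
  induction h with
  | hcore S B T L₁ L₂ M₁ M₂ _ hc => exact grid4_halfCore S B T hc
  | factorP hA _ ih => exact grid4_factorP hA ih
  | factorQ hB _ ih => exact grid4_factorQ hB ih

/-- Disjoint sets give disjoint left cylinders. [this work] -/
theorem disjoint_cylL_of_disjoint {U V : Type} [Fintype U] [DecidableEq U] [Fintype V] [DecidableEq V] {S B : Finset (Pt U)}
    (h : Disjoint S B) : Disjoint (cylL S : Finset (Pt (U ⊕ V))) (cylL B) := by
  rw [disjoint_left]
  intro u hu hu'
  rw [mem_cylL] at hu hu'
  exact disjoint_left.1 h hu hu'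

/-- The invariants carried along the family: `P ∩ b = ∅`, `Q ∩ c = ∅`, `P ⊥ Q`. [this work] -/
theorem invariants_of_isHalfCorePad {κ : Type} [Fintype κ] [DecidableEq κ] {P b Q c : Finset (Pt κ)} (h : IsHalfCorePad κ P b Q c) :
    Disjoint P b ∧ Disjoint Q c ∧ Indep P Q := by
  induction h with
  | hcore S B T L₁ L₂ M₁ M₂ hSB _ =>
    refine ⟨disjoint_cylL_of_disjoint hSB, ?_, indep_cylL_cylR _ _⟩
    rw [cylR_compl]; exact disjoint_compl_right
  | @factorP W κ _ _ _ _ A hA P b Q c _ ih => exact ⟨disjoint_factor A ih.1, disjoint_cylR ih.2.1, indep_factorP A ih.2.2⟩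
  | @factorQ W κ _ _ _ _ B' hB P b Q c _ ih => exact ⟨disjoint_cylR ih.1, disjoint_factor B' ih.2.1, (indep_factorP B' ih.2.2.symm).symm⟩

/-- **TOP-SLICE DOMINANCE WITH THE SHARP CONSTANT `3/2` ON THE CERTIFIED HALF-CORE FAMILY** (every dimension): for every member `(P, b, Q, c)` of
`IsHalfCorePad` and every up-set `F ⊇ P ∪ Q`, `3 · κ(F, P ∪ b, Q ∪ c) ≤ 2 · κ(ofSections F F F, ofSections P P (P ∪ b), ofSections Q Q (Q ∪ c))`
— i.e. `4c₁ ≥ 3c₃` for an ARBITRARY certified prime/cut pair on the `P`-side (times an up-set factor) against a private cut of an arbitrary prime on the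
`Q`-side.  Certificates exist for every nested pair of up-sets `S ⊆ S′ = S ∪ B` of `[3]^U` with `|U| ≤ 2` (memo §2, exhaustive computation); for general `U`
their existence is the pair of one-block conjectures (Uβ), (Uγ). [this work] -/
theorem three_kappa_top_le_two_kappa_lowerStep_of_isHalfCorePad {κ : Type} [Fintype κ] [DecidableEq κ] {P b Q c : Finset (Pt κ)}
    (h : IsHalfCorePad κ P b Q c) {F : Finset (Pt κ)} (hF : IsUpperSet (F : Set (Pt κ))) (hPQ : P ∪ Q ⊆ F) :
    3 * kappa F (P ∪ b) (Q ∪ c) ≤ 2 * kappa (ofSections F F F) (ofSections P P (P ∪ b)) (ofSections Q Q (Q ∪ c)) := by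
  obtain ⟨hPb, hQc, hI⟩ := invariants_of_isHalfCorePad h
  have h0 : kappa F P Q = 0 := kappa_eq_zero_of_indep_of_union_subset hI hPQ
  have hb : (P ∪ b) \ P = b := by
    rw [union_sdiff_left, Finset.sdiff_eq_self_iff_disjoint]; exact hPb.symm
  have hc : (Q ∪ c) \ Q = c := by
    rw [union_sdiff_left, Finset.sdiff_eq_self_iff_disjoint]; exact hQc.symm
  have key := (three_kappa_top_le_iff_psi_nonneg (F := F) (subset_union_left (s₁ := P) (s₂ := b))
    (subset_union_left (s₁ := Q) (s₂ := c)) h0).2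
  rw [hb, hc] at key
  exact key (psi_nonneg_of_grid4 (grid4_of_isHalfCorePad h) hF hPQ)

end Summit.CriticalPhenomena.PercolationContinuityZ3.Theorems.SahiLatin
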